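import Mathlib
import Literature.NumberTheory.Automorphic.FuchsianGroupCusps
import Literature.NumberTheory.Automorphic.AutomorphicKernel

/-!
# Jørgensen's inequality for discrete subgroups of `SL₂(ℝ)`
(Jørgensen, *On discrete groups of Möbius transformations*, Amer. J. Math. 98 (1976), 739–749,
Lemma 1 / Theorem 1; Beardon, *The Geometry of Discrete Groups*, GTM 91, §5.4, Thm 5.4.1;
Iwaniec, *Spectral Methods of Automorphic Forms*, GSM 53, §2.1, PDF pp. 27–28)

Third brick of the theory of a GENERAL discrete `Γ ≤ SL₂(ℝ)` (after `FuchsianGroupCusps.lean` and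
`FuchsianCuspZones.lean`), towards the compactness of the central part `F(Y)` of a fundamental
domain of finite volume ((2.5), Siegel's theorem, stated without proof in Iwaniec's Prop. 2.3–2.5),
which the general finite-volume cases of `Iwaniec2002_thm_7_4` / `Iwaniec2002_eq_12_5` need. The
plan for that compactness is the thick–thin decomposition, whose engine — the Margulis lemma for
`ℍ²` — we take in Jørgensen's explicit form. Jørgensen's inequality: if `A, B ∈ SL₂(ℂ)` generate a
discrete non-elementary group then `|tr²A - 4| + |tr(ABA⁻¹B⁻¹) - 2| ≥ 1`. This file proves it for
`SL₂(ℝ)`, in the concrete contrapositive forms in which it is used ("if the inequality fails, `B`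
fixes the fixed points of `A`"), separately for `A` elliptic and `A` hyperbolic; the parabolic case
is Shimizu's lemma (`Fuchsian.one_le_abs_mul_of_mem`, `FuchsianGroupCusps.lean`). Everything is
proved; nothing is vendored; no fact is introduced.

The proofs follow Jørgensen's iteration `B₀ = B`, `B_{n+1} = B_n A B_n⁻¹`, but — as in the tree's
Shimizu lemma — the limiting argument is replaced by the norm-ball finiteness of
`IsDiscreteSubgroup`: a strictly decreasing positive invariant along the iteration produces
infinitely many distinct elements of `Γ` in one norm ball.

1. (§1) **Elliptic case.** For `A = (a -c; c a) ∈ SL₂(ℝ)` fixing `i` (`a² + c² = 1`) and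
   `B ∈ SL₂(ℝ)`, with `u(B) = u(Bi, i) = (‖B‖² - 2)/4` the point-pair invariant
   (`pointPairInv`, `4u + 2 = ‖B‖²`): `tr(ABA⁻¹B⁻¹) - 2 = 4c² u(B)` (`trace_comm_sub_two_eq`), so
   `J(A, B) := |tr²A - 4| + |tr[A, B] - 2| = 4c²(1 + u(B))` (`jorgensenJ_elliptic_eq`), and
   `u(BAB⁻¹) = 4c² u(B)(1 + u(B)) = J(A,B) u(B)` (`pointPairInv_conj_eq`). Hence
   **`jorgensen_elliptic_I`**: if `Γ ≤ SL₂(ℝ)` is discrete, `A, B ∈ Γ`, `A i = i`, `A ≠ ±1` and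
   `J(A, B) < 1`, then `B i = i`; and in invariant form **`jorgensen_elliptic`**: for `A ∈ Γ`
   fixing `p ∈ ℍ`, `A ≠ ±1`, and `B ∈ Γ` with `B p ≠ p`,
   `(4 - tr²A)(1 + sinh²(ρ(p, Bp)/2)) ≥ 1` — two fixed points of conjugate elliptic elements of
   small rotation angle are far apart.
2. (§2) **Hyperbolic case.** For `D = diag(l, l⁻¹)`, `l² ≠ 1`, and `B = (a b; c d)`:
   `tr(DBD⁻¹B⁻¹) - 2 = -bc(l - l⁻¹)²`, `J(D, B) = (l - l⁻¹)²(1 + |bc|)`, and the iterate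
   `B' = BDB⁻¹` has `b'c' = -bc(1 + bc)(l - l⁻¹)²`. In a discrete `Γ ∋ D` a triangular element is
   diagonal (`apply_01_eq_zero_of_apply_10_eq_zero`: otherwise `[D, X]` is a translation sharing
   the fixed point `∞` with the hyperbolic `D`, excluded by `FuchsianGroupCusps`). Hence
   **`jorgensen_hyperbolic_diag`**: if `D, B ∈ Γ` discrete and `J(D, B) < 1` then `B` is diagonal
   or antidiagonal, i.e. `B` preserves the axis `{0, ∞}` of `D` (the rebalancing `D⁻ᵏB_nDᵏ` keeps
   the iterates in a norm ball).
3. (§3) The invariant form of the elliptic case and the dictionary with displacements: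
   `4u(gi, i) + 2 = ‖g‖²`, `u = sinh²(ρ/2)` (tree), and for later use the displacement of an
   elliptic element: `u(q, Aq) = 4c² u(p, q)(1 + u(p, q))` for `A` fixing `p` with `4c² = 4 - tr²A`
   (`pointPairInv_smul_self_eq`), i.e. `sinh(ρ(q, Aq)/2) = sinh ρ(p, q) · |sin(θ)|` for the rotation
   by `2θ`; the trace is a conjugation invariant (`trace_conj_eq`).

## References
* [Jorgensen1976] T. Jørgensen, On discrete groups of Möbius transformations, Amer. J. Math. 98
  (1976), 739–749: Lemma 1 (the inequality) and its proof by the iteration `B_{n+1} = B_nAB_n⁻¹`.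
* [Beardon1983] A. F. Beardon, *The Geometry of Discrete Groups*, GTM 91, Springer 1983, §5.4,
  Theorem 5.4.1 (Jørgensen's inequality) with the proof via (5.4.3)–(5.4.4), Cases 1–2 (read in
  the galaxy copy `panama:511831252664321`, chars 285700–292500).
* [Iwaniec2002] H. Iwaniec, *Spectral Methods of Automorphic Forms*, 2nd ed., GSM 53, AMS 2002,
  §2.1 (discrete groups, Prop. 2.2), PDF pp. 27–28.

Mathlib: `UpperHalfPlane.gl_smul_I_eq_I_iff_of_pos` (stabiliser of `i`), `exists_mem_Ico_zpow`
(rebalancing exponent), `MulAction.IsPretransitive SL(2, ℝ) ℍ`. Literature: `pointPairInv`,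
`pointPairInv_smul`, `four_mul_pointPairInv_toGL_smul_I_add_two` (`HyperbolicLatticeCount.lean`,
`AutomorphicKernel.lean`); `IsDiscreteSubgroup` (`HyperbolicLaplaceSpectrum.lean`),
`IsDiscreteSubgroup.conj`, `Fuchsian.conj_le_range`, `Fuchsian.mem_conj_inv_iff`,
`Fuchsian.eq_upperRightHom_or_neg_of_upperTriangular`, `Fuchsian.isCusp_infty_of_mem`
(`FuchsianGroupCusps.lean`). Neither Mathlib nor Literature had Jørgensen's inequality or any
Margulis-type lemma (`lean search 'Jorgensen|Jørgensen|Margulis lemma|elementary group'`: no hits).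
-/

noncomputable section

namespace Literature.NumberTheory.Automorphic

namespace Fuchsian

open Matrix UpperHalfPlane
open scoped _root_.MatrixGroups _root_.Pointwise

variable {Γ : Subgroup (GL (Fin 2) ℝ)}

/-! ## 0. Small helpers on `SL₂(ℝ)` and the point-pair invariant -/

section Helpers

/-- The squared Frobenius norm of `g ∈ SL₂(ℝ)`. [cite: Iwaniec2002, §2.1, PDF p. 27] -/
def slNormSq (g : SL(2, ℝ)) : ℝ := g 0 0 ^ 2 + g 0 1 ^ 2 + g 1 0 ^ 2 + g 1 1 ^ 2

/-- `slNormSq` unfolded. [folklore] -/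
theorem slNormSq_def (g : SL(2, ℝ)) : slNormSq g = g 0 0 ^ 2 + g 0 1 ^ 2 + g 1 0 ^ 2 + g 1 1 ^ 2 := rfl

/-- `4 u(gi, i) + 2 = ‖g‖²` (the identity behind `finite_hypBall`). [cite: Iwaniec2002, Ch. 12, PDF p. 126] -/
theorem four_mul_pointPairInv_add_two (g : SL(2, ℝ)) :
    4 * pointPairInv ((Matrix.SpecialLinearGroup.toGL g : GL (Fin 2) ℝ) • I) I + 2 = slNormSq g :=
  four_mul_pointPairInv_toGL_smul_I_add_two g

/-- `ad - bc = 1`. [folklore] -/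
theorem det_rel (g : SL(2, ℝ)) : g 0 0 * g 1 1 - g 0 1 * g 1 0 = 1 := by
  have := g.det_coe
  rwa [Matrix.det_fin_two] at this

/-- Entries of a product in `SL₂(ℝ)`. [folklore] -/
theorem mul_apply_fin_two (g h : SL(2, ℝ)) :
    (g * h) 0 0 = g 0 0 * h 0 0 + g 0 1 * h 1 0 ∧ (g * h) 0 1 = g 0 0 * h 0 1 + g 0 1 * h 1 1 ∧
      (g * h) 1 0 = g 1 0 * h 0 0 + g 1 1 * h 1 0 ∧ (g * h) 1 1 = g 1 0 * h 0 1 + g 1 1 * h 1 1 := by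
  simp [Matrix.SpecialLinearGroup.coe_mul, Matrix.mul_apply, Fin.sum_univ_two]

/-- Entries of the inverse in `SL₂(ℝ)`: `(a b; c d)⁻¹ = (d -b; -c a)`. [folklore] -/
theorem inv_apply_fin_two (g : SL(2, ℝ)) :
    (g⁻¹) 0 0 = g 1 1 ∧ (g⁻¹) 0 1 = -g 0 1 ∧ (g⁻¹) 1 0 = -g 1 0 ∧ (g⁻¹) 1 1 = g 0 0 := by
  simp [Matrix.SpecialLinearGroup.coe_inv, Matrix.adjugate_fin_two]

/-- The point-pair invariant vanishes only on the diagonal. [folklore] -/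
theorem pointPairInv_eq_zero_iff (z w : ℍ) : pointPairInv z w = 0 ↔ z = w := by
  constructor
  · intro h
    rw [pointPairInv, div_eq_zero_iff] at h
    rcases h with h | h
    · have : dist (z : ℂ) w = 0 := by
        have := pow_eq_zero_iff (n := 2) (two_ne_zero) |>.mp h
        exact this
      exact UpperHalfPlane.ext (dist_eq_zero.mp this)
    · exfalso
      have : (0 : ℝ) < 4 * z.im * w.im := by
        have := z.im_pos; have := w.im_pos; positivity
      linarith
  · rintro rfl
    exact pointPairInv_self z

/-- A discrete group has finitely many elements of bounded `‖·‖²`, in `SL₂(ℝ)` form: an injective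
sequence of elements of `Γ` in one norm ball is impossible. [cite: Iwaniec2002, §2.1, PDF p. 27] -/
theorem not_injective_of_slNormSq_le (hd : IsDiscreteSubgroup Γ) {f : ℕ → SL(2, ℝ)}
    (hmem : ∀ n, (Matrix.SpecialLinearGroup.toGL (f n) : GL (Fin 2) ℝ) ∈ Γ) {R : ℝ}
    (hR : ∀ n, slNormSq (f n) ≤ R) (hinj : Function.Injective f) : False := by
  have hinj' : Function.Injective fun n => (Matrix.SpecialLinearGroup.toGL (f n) : GL (Fin 2) ℝ) :=
    fun m n h => hinj (Matrix.SpecialLinearGroup.toGL_injective h)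
  refine (Set.infinite_of_injective_forall_mem hinj' (s := {γ : GL (Fin 2) ℝ | γ ∈ Γ ∧
    (γ 0 0 : ℝ) ^ 2 + (γ 0 1 : ℝ) ^ 2 + (γ 1 0 : ℝ) ^ 2 + (γ 1 1 : ℝ) ^ 2 ≤ R}) fun n => ?_) (hd R)
  exact ⟨hmem n, hR n⟩

end Helpers

/-! ## 1. The elliptic case -/

section Elliptic

/-- An element of `SL₂(ℝ)` fixing `i` is a rotation matrix `(a -c; c a)`, `a² + c² = 1`.
[cite: Iwaniec2002, §1.3 (1.16), PDF p. 15] -/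
theorem eq_rot_of_smul_I {A : SL(2, ℝ)} (hA : (Matrix.SpecialLinearGroup.toGL A : GL (Fin 2) ℝ) • I = I) :
    A 1 1 = A 0 0 ∧ A 0 1 = -A 1 0 ∧ A 0 0 ^ 2 + A 1 0 ^ 2 = 1 := by
  have hdet : 0 < ((Matrix.SpecialLinearGroup.toGL A : GL (Fin 2) ℝ)).det.val := by simp
  obtain ⟨h1, h2⟩ := (UpperHalfPlane.gl_smul_I_eq_I_iff_of_pos hdet).mp hA
  have e : ∀ i j, (Matrix.SpecialLinearGroup.toGL A : GL (Fin 2) ℝ) i j = A i j := fun i j => rfl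
  rw [e, e] at h1 h2
  have hd := det_rel A
  refine ⟨h1.symm, h2, ?_⟩
  rw [← h1, h2] at hd
  nlinarith

/-- For a rotation `A` about `i`, `tr²A - 4 = -4c²`. [folklore] -/
theorem trace_sq_sub_four_of_smul_I {A : SL(2, ℝ)}
    (hA : (Matrix.SpecialLinearGroup.toGL A : GL (Fin 2) ℝ) • I = I) :
    (A 0 0 + A 1 1) ^ 2 - 4 = -4 * A 1 0 ^ 2 := by
  obtain ⟨h1, -, h3⟩ := eq_rot_of_smul_I hA
  rw [h1]
  nlinarith

/-- A rotation about `i` other than `±1` has `c ≠ 0`. [folklore] -/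
theorem apply_10_ne_zero_of_smul_I {A : SL(2, ℝ)}
    (hA : (Matrix.SpecialLinearGroup.toGL A : GL (Fin 2) ℝ) • I = I) (h1 : A ≠ 1) (h2 : A ≠ -1) :
    A 1 0 ≠ 0 := by
  intro hc
  obtain ⟨hd, hb, hac⟩ := eq_rot_of_smul_I hA
  rw [hc] at hac hb
  have ha : A 0 0 = 1 ∨ A 0 0 = -1 := by
    have : A 0 0 ^ 2 = 1 := by nlinarith
    exact sq_eq_one_iff.mp this |>.imp id id
  rcases ha with ha | ha
  · apply h1
    ext i j
    fin_cases i <;> fin_cases j <;> simp [ha, hb, hc, hd]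
  · apply h2
    ext i j
    fin_cases i <;> fin_cases j <;> simp [ha, hb, hc, hd, Matrix.SpecialLinearGroup.coe_neg]

/-- **The trace of the commutator** of a rotation `A = (a -c; c a)` about `i` and any
`B ∈ SL₂(ℝ)`: `tr(ABA⁻¹B⁻¹) - 2 = c²(‖B‖² - 2) = 4c² u(Bi, i)` (in geometric terms
`|tr[A,B] - 2| = 4 sin²θ sinh²(ρ(i, Bi)/2)` for the rotation by `2θ`).
[cite: Beardon1983, Thm 5.4.1, proof (Case 2)] -/
theorem trace_comm_sub_two_eq {A : SL(2, ℝ)}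
    (hA : (Matrix.SpecialLinearGroup.toGL A : GL (Fin 2) ℝ) • I = I) (B : SL(2, ℝ)) :
    (A * B * A⁻¹ * B⁻¹) 0 0 + (A * B * A⁻¹ * B⁻¹) 1 1 - 2 = A 1 0 ^ 2 * (slNormSq B - 2) := by
  obtain ⟨h1, h2, h3⟩ := eq_rot_of_smul_I hA
  have hdB := det_rel B
  rw [slNormSq_def]
  simp only [Matrix.SpecialLinearGroup.coe_mul, Matrix.SpecialLinearGroup.coe_inv,
    Matrix.adjugate_fin_two, Matrix.mul_apply, Fin.sum_univ_two, Matrix.of_apply, Matrix.cons_val',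
    Matrix.cons_val_zero, Matrix.cons_val_one, Matrix.cons_val_fin_one, Matrix.empty_val']
  rw [h1, h2]
  linear_combination (2 * A 0 0 ^ 2) * hdB + 2 * h3

/-- **Jørgensen's quantity in the elliptic case**: for a rotation `A` about `i`,
`|tr²A - 4| + |tr(ABA⁻¹B⁻¹) - 2| = 4c²(1 + u(Bi, i))`. [cite: Jorgensen1976, Lemma 1] -/
theorem jorgensenJ_elliptic_eq {A : SL(2, ℝ)}
    (hA : (Matrix.SpecialLinearGroup.toGL A : GL (Fin 2) ℝ) • I = I) (B : SL(2, ℝ)) :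
    |(A 0 0 + A 1 1) ^ 2 - 4| + |(A * B * A⁻¹ * B⁻¹) 0 0 + (A * B * A⁻¹ * B⁻¹) 1 1 - 2| =
      4 * A 1 0 ^ 2 * (1 + pointPairInv ((Matrix.SpecialLinearGroup.toGL B : GL (Fin 2) ℝ) • I) I) := by
  rw [trace_sq_sub_four_of_smul_I hA, trace_comm_sub_two_eq hA B, ← four_mul_pointPairInv_add_two B]
  have hu := pointPairInv_nonneg ((Matrix.SpecialLinearGroup.toGL B : GL (Fin 2) ℝ) • I) I
  have hc : 0 ≤ A 1 0 ^ 2 := sq_nonneg _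
  have e1 : -4 * A 1 0 ^ 2 ≤ 0 := by linarith
  have e2 : 0 ≤ A 1 0 ^ 2 * (4 * pointPairInv ((Matrix.SpecialLinearGroup.toGL B : GL (Fin 2) ℝ) • I) I + 2 - 2) := by
    apply mul_nonneg hc; linarith
  rw [abs_of_nonpos e1, abs_of_nonneg e2]
  ring

/-- The norm along Jørgensen's iteration: `‖BAB⁻¹‖² - 2 = c²(‖B‖⁴ - 4)` for a rotation
`A = (a -c; c a)` about `i` (write `A = a·1 + c·J`, `J = (0 -1; 1 0)`; then `‖BJB⁻¹‖² = ‖B‖⁴ - 2`).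
[cite: Jorgensen1976, proof of Lemma 1] -/
theorem slNormSq_conj_sub_two_eq {A : SL(2, ℝ)}
    (hA : (Matrix.SpecialLinearGroup.toGL A : GL (Fin 2) ℝ) • I = I) (B : SL(2, ℝ)) :
    slNormSq (B * A * B⁻¹) - 2 = A 1 0 ^ 2 * (slNormSq B ^ 2 - 4) := by
  obtain ⟨h1, h2, h3⟩ := eq_rot_of_smul_I hA
  have hdB := det_rel B
  rw [slNormSq_def, slNormSq_def]
  simp only [Matrix.SpecialLinearGroup.coe_mul, Matrix.SpecialLinearGroup.coe_inv,
    Matrix.adjugate_fin_two, Matrix.mul_apply, Fin.sum_univ_two, Matrix.of_apply, Matrix.cons_val',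
    Matrix.cons_val_zero, Matrix.cons_val_one, Matrix.cons_val_fin_one, Matrix.empty_val']
  rw [h1, h2]
  linear_combination (2 * (B 0 0 * B 1 1 - B 0 1 * B 1 0 + 1) * (A 0 0 ^ 2 - A 1 0 ^ 2)) * hdB + 2 * h3

/-- **The point-pair invariant along Jørgensen's iteration**: for a rotation `A = (a -c; c a)`
about `i` and `B ∈ SL₂(ℝ)`, `u(BAB⁻¹ i, i) = 4c² u(Bi, i)(1 + u(Bi, i))`. Geometrically:
`sinh(ρ(q, Aq)/2) = sinh ρ(i, q) · |sin θ|` for the rotation by `2θ`, `q = B⁻¹i`.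
[cite: Beardon1983, Thm 5.4.1, proof (5.4.3)] -/
theorem pointPairInv_conj_eq {A : SL(2, ℝ)}
    (hA : (Matrix.SpecialLinearGroup.toGL A : GL (Fin 2) ℝ) • I = I) (B : SL(2, ℝ)) :
    pointPairInv ((Matrix.SpecialLinearGroup.toGL (B * A * B⁻¹) : GL (Fin 2) ℝ) • I) I =
      4 * A 1 0 ^ 2 * pointPairInv ((Matrix.SpecialLinearGroup.toGL B : GL (Fin 2) ℝ) • I) I *
        (1 + pointPairInv ((Matrix.SpecialLinearGroup.toGL B : GL (Fin 2) ℝ) • I) I) := by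
  have key := slNormSq_conj_sub_two_eq hA B
  rw [← four_mul_pointPairInv_add_two, ← four_mul_pointPairInv_add_two] at key
  linear_combination (1 / 4 : ℝ) * key

/-- Jørgensen's iteration `B₀ = B`, `B_{n+1} = B_n A B_n⁻¹`. [cite: Jorgensen1976, proof of Lemma 1] -/
def jorgensenSeq (A B : SL(2, ℝ)) : ℕ → SL(2, ℝ)
  | 0 => B
  | n + 1 => jorgensenSeq A B n * A * (jorgensenSeq A B n)⁻¹

/-- `B₀ = B`. [cite: Jorgensen1976, proof of Lemma 1] -/
theorem jorgensenSeq_zero (A B : SL(2, ℝ)) : jorgensenSeq A B 0 = B := rfl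

/-- `B_{n+1} = B_n A B_n⁻¹`. [cite: Jorgensen1976, proof of Lemma 1] -/
theorem jorgensenSeq_succ (A B : SL(2, ℝ)) (n : ℕ) :
    jorgensenSeq A B (n + 1) = jorgensenSeq A B n * A * (jorgensenSeq A B n)⁻¹ := rfl

/-- The iterates stay in `Γ`. [cite: Jorgensen1976, proof of Lemma 1] -/
theorem toGL_jorgensenSeq_mem {A B : SL(2, ℝ)}
    (hA : (Matrix.SpecialLinearGroup.toGL A : GL (Fin 2) ℝ) ∈ Γ)
    (hB : (Matrix.SpecialLinearGroup.toGL B : GL (Fin 2) ℝ) ∈ Γ) (n : ℕ) :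
    (Matrix.SpecialLinearGroup.toGL (jorgensenSeq A B n) : GL (Fin 2) ℝ) ∈ Γ := by
  induction n with
  | zero => exact hB
  | succ n ih =>
    rw [jorgensenSeq_succ, map_mul, map_mul, map_inv]
    exact Γ.mul_mem (Γ.mul_mem ih hA) (Γ.inv_mem ih)

/-- **Jørgensen's inequality, elliptic case, normalised at `i`.** Let `Γ ≤ SL₂(ℝ)` (inside
`GL₂(ℝ)`) be discrete, `A ∈ Γ` a rotation about `i` other than `±1`, and `B ∈ Γ`. If
`|tr²A - 4| + |tr(ABA⁻¹B⁻¹) - 2| < 1` then `B` fixes `i`. (Along the iteration,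
`u_{n+1} = J_n u_n` with `J_n = 4c²(1 + u_n) ≤ J_0 < 1`; if `u_0 > 0` the `u_n` decrease strictly,
giving infinitely many distinct `B_n ∈ Γ` with `‖B_n‖² = 2 + 4u_n ≤ 2 + 4u_0` — impossible; so
`u_0 = 0`.) [cite: Jorgensen1976, Lemma 1 & Thm 1] [cite: Beardon1983, Thm 5.4.1] -/
theorem jorgensen_elliptic_I (hd : IsDiscreteSubgroup Γ) {A B : SL(2, ℝ)}
    (hA : (Matrix.SpecialLinearGroup.toGL A : GL (Fin 2) ℝ) ∈ Γ)
    (hB : (Matrix.SpecialLinearGroup.toGL B : GL (Fin 2) ℝ) ∈ Γ)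
    (hAI : (Matrix.SpecialLinearGroup.toGL A : GL (Fin 2) ℝ) • I = I) (h1 : A ≠ 1) (h2 : A ≠ -1)
    (hJ : |(A 0 0 + A 1 1) ^ 2 - 4| + |(A * B * A⁻¹ * B⁻¹) 0 0 + (A * B * A⁻¹ * B⁻¹) 1 1 - 2| < 1) :
    (Matrix.SpecialLinearGroup.toGL B : GL (Fin 2) ℝ) • I = I := by
  rw [jorgensenJ_elliptic_eq hAI] at hJ
  set μ : ℝ := 4 * A 1 0 ^ 2 with hμ
  have hμ0 : 0 < μ := by
    have := apply_10_ne_zero_of_smul_I hAI h1 h2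
    positivity
  -- the invariants `u_n`
  set u : ℕ → ℝ := fun n =>
    pointPairInv ((Matrix.SpecialLinearGroup.toGL (jorgensenSeq A B n) : GL (Fin 2) ℝ) • I) I with hu
  have hu0 : ∀ n, 0 ≤ u n := fun n => pointPairInv_nonneg _ _
  have hrec : ∀ n, u (n + 1) = μ * u n * (1 + u n) := fun n => by
    simp only [hu, jorgensenSeq_succ]
    rw [pointPairInv_conj_eq hAI]
  -- `u_n ≤ u_0` and `u_{n+1} ≤ J_0 u_n`
  set J₀ : ℝ := μ * (1 + u 0) with hJ₀
  have hJ0 : J₀ < 1 := hJ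
  have hmono : ∀ n, u n ≤ u 0 := by
    intro n
    induction n with
    | zero => exact le_rfl
    | succ n ih =>
      rw [hrec]
      calc μ * u n * (1 + u n) ≤ μ * u n * (1 + u 0) := by
            have h := mul_nonneg hμ0.le (hu0 n)
            nlinarith [ih]
        _ = J₀ * u n := by rw [hJ₀]; ring
        _ ≤ 1 * u n := by gcongr; exact hu0 n
        _ ≤ u 0 := by rw [one_mul]; exact ih
  -- if `u_0 = 0` we are done
  by_cases h0 : u 0 = 0
  · have : pointPairInv ((Matrix.SpecialLinearGroup.toGL B : GL (Fin 2) ℝ) • I) I = 0 := h0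
    exact (pointPairInv_eq_zero_iff _ _).mp this
  exfalso
  have hpos0 : 0 < u 0 := lt_of_le_of_ne (hu0 0) (Ne.symm h0)
  -- otherwise all `u_n > 0` and they decrease strictly
  have hpos : ∀ n, 0 < u n := by
    intro n
    induction n with
    | zero => exact hpos0
    | succ n ih => rw [hrec]; positivity
  have hanti : StrictAnti u := by
    refine strictAnti_nat_of_succ_lt fun n => ?_
    rw [hrec]
    calc μ * u n * (1 + u n) ≤ μ * u n * (1 + u 0) := by
          have h := mul_nonneg hμ0.le (hu0 n)
          nlinarith [hmono n]
      _ = J₀ * u n := by rw [hJ₀]; ring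
      _ < 1 * u n := by gcongr; exact hpos n
      _ = u n := one_mul _
  -- hence the `B_n` are distinct, yet in one norm ball
  have hball : ∀ n, slNormSq (jorgensenSeq A B n) ≤ 4 * u 0 + 2 := by
    intro n
    rw [← four_mul_pointPairInv_add_two]
    have := hmono n
    simp only [hu] at this ⊢
    linarith
  have hinj : Function.Injective (jorgensenSeq A B) := by
    intro m n hmn
    have : u m = u n := by simp only [hu, hmn]
    exact hanti.injective this
  exact not_injective_of_slNormSq_le hd (toGL_jorgensenSeq_mem hA hB) hball hinj

/-- The trace is a conjugation invariant in `SL₂(ℝ)`. [folklore] -/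
theorem trace_conj_eq (g a : SL(2, ℝ)) : (g⁻¹ * a * g) 0 0 + (g⁻¹ * a * g) 1 1 = a 0 0 + a 1 1 := by
  have hdg := det_rel g
  simp only [Matrix.SpecialLinearGroup.coe_mul, Matrix.SpecialLinearGroup.coe_inv,
    Matrix.adjugate_fin_two, Matrix.mul_apply, Fin.sum_univ_two, Matrix.of_apply, Matrix.cons_val',
    Matrix.cons_val_zero, Matrix.cons_val_one, Matrix.cons_val_fin_one, Matrix.empty_val']
  linear_combination (a 0 0 + a 1 1) * hdg

/-- Conjugating into the frame of `i`: `g⁻¹ a g` fixes `i` when `a` fixes `g i`. [folklore] -/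
theorem conj_smul_I_eq {g a : SL(2, ℝ)} {p : ℍ} (hg : g • I = p)
    (ha : (Matrix.SpecialLinearGroup.toGL a : GL (Fin 2) ℝ) • p = p) :
    (Matrix.SpecialLinearGroup.toGL (g⁻¹ * a * g) : GL (Fin 2) ℝ) • I = I := by
  have e : ∀ (x : SL(2, ℝ)) (z : ℍ), (Matrix.SpecialLinearGroup.toGL x : GL (Fin 2) ℝ) • z = x • z :=
    fun x z => rfl
  rw [e] at ha ⊢
  rw [mul_smul, mul_smul, hg, ha, ← hg, inv_smul_smul]

/-- **The displacement of an elliptic element** (invariant form of `pointPairInv_conj_eq`): if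
`A ∈ SL₂(ℝ)` fixes `p` then for every `q`,
`u(q, Aq) = (4 - tr²A) · u(p, q) · (1 + u(p, q))`, i.e. `sinh(ρ(q, Aq)/2) = sinh ρ(p, q)·|sin θ|`
for the rotation by `2θ` about `p` (`4 - tr²A = 4 sin²θ`). [folklore] -/
theorem pointPairInv_smul_self_eq {A : SL(2, ℝ)} {p : ℍ}
    (hA : (Matrix.SpecialLinearGroup.toGL A : GL (Fin 2) ℝ) • p = p) (q : ℍ) :
    pointPairInv q ((Matrix.SpecialLinearGroup.toGL A : GL (Fin 2) ℝ) • q) =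
      (4 - (A 0 0 + A 1 1) ^ 2) * pointPairInv p q * (1 + pointPairInv p q) := by
  have e : ∀ (x : SL(2, ℝ)) (z : ℍ), (Matrix.SpecialLinearGroup.toGL x : GL (Fin 2) ℝ) • z = x • z :=
    fun x z => rfl
  obtain ⟨g, hg⟩ := MulAction.exists_smul_eq SL(2, ℝ) I p
  set A' : SL(2, ℝ) := g⁻¹ * A * g with hA'
  have hA'I : (Matrix.SpecialLinearGroup.toGL A' : GL (Fin 2) ℝ) • I = I := conj_smul_I_eq hg hA
  -- move `q` into the frame and choose `B` with `B (g⁻¹ q) = i`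
  obtain ⟨B, hB⟩ := MulAction.exists_smul_eq SL(2, ℝ) (g⁻¹ • q) I
  have key := pointPairInv_conj_eq hA'I B
  -- identify the three point-pair invariants
  have h1 : pointPairInv ((Matrix.SpecialLinearGroup.toGL B : GL (Fin 2) ℝ) • I) I = pointPairInv p q := by
    rw [e]
    conv_lhs => arg 2; rw [← hB]
    rw [pointPairInv_smul, ← pointPairInv_smul g I (g⁻¹ • q), smul_inv_smul, hg]
  have h2 : pointPairInv ((Matrix.SpecialLinearGroup.toGL (B * A' * B⁻¹) : GL (Fin 2) ℝ) • I) I =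
      pointPairInv q ((Matrix.SpecialLinearGroup.toGL A : GL (Fin 2) ℝ) • q) := by
    rw [e, e]
    conv_lhs => rw [← hB]
    rw [mul_smul, mul_smul, inv_smul_smul, pointPairInv_smul, hA', mul_smul, mul_smul, smul_inv_smul,
      pointPairInv_smul, pointPairInv_comm]
  have h3 : (A' 1 0) ^ 2 * 4 = 4 - (A 0 0 + A 1 1) ^ 2 := by
    have := trace_sq_sub_four_of_smul_I hA'I
    rw [hA', trace_conj_eq] at this
    linarith
  rw [h1, h2] at key
  rw [key, ← h3]
  ring

/-- **Jørgensen's inequality, elliptic case (invariant form).** Let `Γ ≤ SL₂(ℝ)` (inside `GL₂(ℝ)`)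
be discrete, `A ∈ Γ` an element other than `±1` fixing `p ∈ ℍ`, and `B ∈ Γ` with `B p ≠ p`. Then
`(4 - tr²A)(1 + u(Bp, p)) ≥ 1`, i.e. `|tr²A - 4| + |tr(ABA⁻¹B⁻¹) - 2| ≥ 1` — the group `⟨A, B⟩`
not being elementary. In particular two fixed points of conjugate elliptic elements of small angle
are far apart: `sinh²(ρ(p, Bp)/2) ≥ 1/(4 sin²θ) - 1`. [cite: Jorgensen1976, Lemma 1 & Thm 1] [cite: Beardon1983, Thm 5.4.1] -/
theorem jorgensen_elliptic
    (hΓ : Γ ≤ (Matrix.SpecialLinearGroup.toGL : SL(2, ℝ) →* GL (Fin 2) ℝ).range)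
    (hd : IsDiscreteSubgroup Γ) {A B : GL (Fin 2) ℝ} (hA : A ∈ Γ) (hB : B ∈ Γ) {p : ℍ}
    (hAp : A • p = p) (h1 : A ≠ 1) (h2 : A ≠ -1) (hBp : B • p ≠ p) :
    1 ≤ (4 - ((A 0 0 : ℝ) + A 1 1) ^ 2) * (1 + pointPairInv (B • p) p) := by
  obtain ⟨a, rfl⟩ := hΓ hA
  obtain ⟨b, rfl⟩ := hΓ hB
  have e : ∀ (x : SL(2, ℝ)) (z : ℍ), (Matrix.SpecialLinearGroup.toGL x : GL (Fin 2) ℝ) • z = x • z :=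
    fun x z => rfl
  have eA : ∀ i j, (Matrix.SpecialLinearGroup.toGL a : GL (Fin 2) ℝ) i j = a i j := fun i j => rfl
  obtain ⟨g, hg⟩ := MulAction.exists_smul_eq SL(2, ℝ) I p
  set G : GL (Fin 2) ℝ := Matrix.SpecialLinearGroup.toGL g with hG
  set Γ' : Subgroup (GL (Fin 2) ℝ) := ConjAct.toConjAct G⁻¹ • Γ with hΓ'
  have hd' : IsDiscreteSubgroup Γ' := hd.conj _
  set a' : SL(2, ℝ) := g⁻¹ * a * g with ha'
  set b' : SL(2, ℝ) := g⁻¹ * b * g with hb'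
  have hmem : ∀ x : SL(2, ℝ), (Matrix.SpecialLinearGroup.toGL x : GL (Fin 2) ℝ) ∈ Γ →
      (Matrix.SpecialLinearGroup.toGL (g⁻¹ * x * g) : GL (Fin 2) ℝ) ∈ Γ' := by
    intro x hx
    rw [hΓ', mem_conj_inv_iff, map_mul, map_mul, map_inv, hG]
    have : (Matrix.SpecialLinearGroup.toGL g : GL (Fin 2) ℝ) *
        ((Matrix.SpecialLinearGroup.toGL g : GL (Fin 2) ℝ)⁻¹ * Matrix.SpecialLinearGroup.toGL x *
          Matrix.SpecialLinearGroup.toGL g) * (Matrix.SpecialLinearGroup.toGL g : GL (Fin 2) ℝ)⁻¹ =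
        Matrix.SpecialLinearGroup.toGL x := by group
    rw [this]
    exact hx
  have ha'mem := hmem a hA
  have hb'mem := hmem b hB
  have ha'I : (Matrix.SpecialLinearGroup.toGL a' : GL (Fin 2) ℝ) • I = I := conj_smul_I_eq hg hAp
  have ha'1 : a' ≠ 1 := by
    intro h
    apply h1
    have : a = 1 := by
      have : g⁻¹ * a * g = 1 := h
      calc a = g * (g⁻¹ * a * g) * g⁻¹ := by group
        _ = 1 := by rw [this]; group
    rw [this, map_one]
  have ha'2 : a' ≠ -1 := by
    intro h
    apply h2
    have : a = -1 := by
      have : g⁻¹ * a * g = -1 := h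
      calc a = g * (g⁻¹ * a * g) * g⁻¹ := by group
        _ = -1 := by rw [this]; simp
    rw [this, toGL_neg, map_one]
  -- if the inequality failed, `b'` would fix `i`, i.e. `b` would fix `p`
  by_contra hlt
  rw [not_le] at hlt
  have hJ : |(a' 0 0 + a' 1 1) ^ 2 - 4| + |(a' * b' * a'⁻¹ * b'⁻¹) 0 0 + (a' * b' * a'⁻¹ * b'⁻¹) 1 1 - 2| < 1 := by
    rw [jorgensenJ_elliptic_eq ha'I]
    have h3 : 4 * (a' 1 0) ^ 2 = 4 - (a 0 0 + a 1 1) ^ 2 := by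
      have := trace_sq_sub_four_of_smul_I ha'I
      rw [ha', trace_conj_eq] at this
      linarith
    have h4 : pointPairInv ((Matrix.SpecialLinearGroup.toGL b' : GL (Fin 2) ℝ) • I) I =
        pointPairInv ((Matrix.SpecialLinearGroup.toGL b : GL (Fin 2) ℝ) • p) p := by
      rw [e, e, hb', mul_smul, mul_smul, hg, ← pointPairInv_smul g, smul_inv_smul, hg]
    rw [h3, h4]
    simpa [eA] using hlt
  have hfix := jorgensen_elliptic_I hd' ha'mem hb'mem ha'I ha'1 ha'2 hJ
  apply hBp
  rw [e] at hfix ⊢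
  rw [mul_smul, mul_smul, hg, inv_smul_eq_iff, hg] at hfix
  exact hfix

end Elliptic

/-! ## 2. The hyperbolic case -/

section Hyperbolic

/-- For a diagonal `D ∈ SL₂(ℝ)`, `D 1 1 = (D 0 0)⁻¹` in the form `D 0 0 * D 1 1 = 1`. [folklore] -/
theorem diag_mul_eq_one {D : SL(2, ℝ)} (h01 : D 0 1 = 0) : D 0 0 * D 1 1 = 1 := by
  have := det_rel D
  rw [h01, zero_mul, sub_zero] at this
  exact this

/-- Entries of the iterate `BDB⁻¹` for diagonal `D = diag(l, m)`:
`(adl - bcm, ab(m - l); cd(l - m), adm - bcl)`. [cite: Jorgensen1976, proof of Lemma 1] -/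
theorem conj_diag_apply {D : SL(2, ℝ)} (h01 : D 0 1 = 0) (h10 : D 1 0 = 0) (B : SL(2, ℝ)) :
    (B * D * B⁻¹) 0 0 = B 0 0 * B 1 1 * D 0 0 - B 0 1 * B 1 0 * D 1 1 ∧
      (B * D * B⁻¹) 0 1 = B 0 0 * B 0 1 * (D 1 1 - D 0 0) ∧
      (B * D * B⁻¹) 1 0 = B 1 0 * B 1 1 * (D 0 0 - D 1 1) ∧
      (B * D * B⁻¹) 1 1 = B 0 0 * B 1 1 * D 1 1 - B 0 1 * B 1 0 * D 0 0 := by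
  simp only [Matrix.SpecialLinearGroup.coe_mul, Matrix.SpecialLinearGroup.coe_inv,
    Matrix.adjugate_fin_two, Matrix.mul_apply, Fin.sum_univ_two, Matrix.of_apply, Matrix.cons_val',
    Matrix.cons_val_zero, Matrix.cons_val_one, Matrix.cons_val_fin_one, Matrix.empty_val', h01, h10]
  refine ⟨by ring, by ring, by ring, by ring⟩

/-- The product of the off-diagonal entries along the iteration:
`b'c' = -bc(1 + bc)(l - m)²`. [cite: Jorgensen1976, proof of Lemma 1] -/
theorem offDiag_conj_diag {D : SL(2, ℝ)} (h01 : D 0 1 = 0) (h10 : D 1 0 = 0) (B : SL(2, ℝ)) :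
    (B * D * B⁻¹) 0 1 * (B * D * B⁻¹) 1 0 =
      -(B 0 1 * B 1 0) * (1 + B 0 1 * B 1 0) * (D 0 0 - D 1 1) ^ 2 := by
  obtain ⟨-, e01, e10, -⟩ := conj_diag_apply h01 h10 B
  have hdB := det_rel B
  rw [e01, e10]
  linear_combination (-(B 0 1 * B 1 0) * (D 0 0 - D 1 1) ^ 2) * hdB

/-- **The trace of the commutator** with a diagonal `D = diag(l, l⁻¹)`:
`tr(DBD⁻¹B⁻¹) - 2 = -bc(l - l⁻¹)²`; with `tr²D - 4 = (l - l⁻¹)²`, Jørgensen's quantity is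
`J(D, B) = (l - l⁻¹)²(1 + |bc|)`. [cite: Jorgensen1976, Lemma 1] [cite: Beardon1983, Thm 5.4.1] -/
theorem trace_comm_diag_sub_two {D : SL(2, ℝ)} (h01 : D 0 1 = 0) (h10 : D 1 0 = 0) (B : SL(2, ℝ)) :
    (D * B * D⁻¹ * B⁻¹) 0 0 + (D * B * D⁻¹ * B⁻¹) 1 1 - 2 = -(B 0 1 * B 1 0) * (D 0 0 - D 1 1) ^ 2 := by
  have hdB := det_rel B
  have hdD := diag_mul_eq_one h01
  simp only [Matrix.SpecialLinearGroup.coe_mul, Matrix.SpecialLinearGroup.coe_inv,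
    Matrix.adjugate_fin_two, Matrix.mul_apply, Fin.sum_univ_two, Matrix.of_apply, Matrix.cons_val',
    Matrix.cons_val_zero, Matrix.cons_val_one, Matrix.cons_val_fin_one, Matrix.empty_val', h01, h10]
  linear_combination (2 * D 0 0 * D 1 1) * hdB + 2 * hdD

/-- `tr²D - 4 = (l - l⁻¹)²` for `D = diag(l, l⁻¹)`. [folklore] -/
theorem trace_sq_diag_sub_four {D : SL(2, ℝ)} (h01 : D 0 1 = 0) :
    (D 0 0 + D 1 1) ^ 2 - 4 = (D 0 0 - D 1 1) ^ 2 := by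
  have hdD := diag_mul_eq_one h01
  linear_combination 4 * hdD

/-- Jørgensen's quantity for a diagonal `D`. [cite: Jorgensen1976, Lemma 1] -/
theorem jorgensenJ_diag_eq {D : SL(2, ℝ)} (h01 : D 0 1 = 0) (h10 : D 1 0 = 0) (B : SL(2, ℝ)) :
    |(D 0 0 + D 1 1) ^ 2 - 4| + |(D * B * D⁻¹ * B⁻¹) 0 0 + (D * B * D⁻¹ * B⁻¹) 1 1 - 2| =
      (D 0 0 - D 1 1) ^ 2 * (1 + |B 0 1 * B 1 0|) := by
  rw [trace_sq_diag_sub_four h01, trace_comm_diag_sub_two h01 h10, abs_of_nonneg (sq_nonneg _),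
    neg_mul, abs_neg, abs_mul, abs_of_nonneg (sq_nonneg (D 0 0 - D 1 1))]
  ring

/-- The commutator of a diagonal `D = diag(l, m)` with an upper triangular `X = (x y; 0 w)` is the
translation by `xy(l² - 1)`. [folklore] -/
theorem comm_diag_upper_eq {D X : SL(2, ℝ)} (h01 : D 0 1 = 0) (h10 : D 1 0 = 0) (hX : X 1 0 = 0) :
    (Matrix.SpecialLinearGroup.toGL (D * X * D⁻¹ * X⁻¹) : GL (Fin 2) ℝ) =
      Matrix.GeneralLinearGroup.upperRightHom (X 0 0 * X 0 1 * (D 0 0 ^ 2 - 1)) := by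
  have hdD := diag_mul_eq_one h01
  have hdX := det_rel X
  rw [hX, mul_zero, sub_zero] at hdX
  rw [← toGL_translSL]
  congr 1
  ext i j
  fin_cases i <;> fin_cases j <;>
    simp only [Matrix.SpecialLinearGroup.coe_mul, Matrix.SpecialLinearGroup.coe_inv,
      Matrix.adjugate_fin_two, Matrix.mul_apply, Fin.sum_univ_two, Matrix.of_apply, Matrix.cons_val',
      Matrix.cons_val_zero, Matrix.cons_val_one, Matrix.cons_val_fin_one, Matrix.empty_val', h01, h10,
      hX, translSL_apply_00, translSL_apply_01, translSL_apply_10, translSL_apply_11,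
      Fin.zero_eta, Fin.isValue, Fin.mk_one]
  · linear_combination (X 0 0 * X 1 1) * hdD + hdX
  · linear_combination (-(X 0 0 * X 0 1)) * hdD
  · ring
  · linear_combination (X 0 0 * X 1 1) * hdD + hdX

/-- **In a discrete group containing the hyperbolic `D = diag(l, l⁻¹)`, `l² ≠ 1`, an upper
triangular element is diagonal**: otherwise its commutator with `D` is a non-trivial translation,
making `∞` a cusp whose stabiliser would contain the hyperbolic `D`, which
`eq_upperRightHom_or_neg_of_upperTriangular` forbids (Iwaniec: "the stability group of a cusp is
an infinite cyclic group generated by a parabolic motion"). [cite: Iwaniec2002, Prop. 2.2 & §2.2, PDF pp. 27–30] -/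
theorem apply_01_eq_zero_of_upper
    (hΓ : Γ ≤ (Matrix.SpecialLinearGroup.toGL : SL(2, ℝ) →* GL (Fin 2) ℝ).range)
    (hd : IsDiscreteSubgroup Γ) {D X : SL(2, ℝ)}
    (hD : (Matrix.SpecialLinearGroup.toGL D : GL (Fin 2) ℝ) ∈ Γ)
    (hX : (Matrix.SpecialLinearGroup.toGL X : GL (Fin 2) ℝ) ∈ Γ)
    (h01 : D 0 1 = 0) (h10 : D 1 0 = 0) (hl : D 0 0 ^ 2 ≠ 1) (hX10 : X 1 0 = 0) : X 0 1 = 0 := by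
  by_contra hy
  have hdX := det_rel X
  rw [hX10, mul_zero, sub_zero] at hdX
  have hx : X 0 0 ≠ 0 := by
    intro h0; rw [h0, zero_mul] at hdX; exact zero_ne_one hdX
  set t : ℝ := X 0 0 * X 0 1 * (D 0 0 ^ 2 - 1) with ht
  have ht0 : t ≠ 0 := by
    rw [ht]
    exact mul_ne_zero (mul_ne_zero hx hy) (sub_ne_zero.mpr hl)
  -- the commutator is the translation by `t`, so `∞` is a cusp of `Γ`
  have hmem : Matrix.GeneralLinearGroup.upperRightHom t ∈ Γ := by
    rw [ht, ← comm_diag_upper_eq h01 h10 hX10, map_mul, map_mul, map_mul, map_inv, map_inv]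
    exact Γ.mul_mem (Γ.mul_mem (Γ.mul_mem hD hX) (Γ.inv_mem hD)) (Γ.inv_mem hX)
  have hinf : IsCusp OnePoint.infty Γ := by
    rcases lt_or_gt_of_ne ht0 with hneg | hpos
    · refine Subgroup.isCusp_of_mem_strictPeriods (h := -t) (by linarith) ?_
      exact Γ.strictPeriods.neg_mem (Subgroup.mem_strictPeriods_iff.mpr hmem)
    · exact Subgroup.isCusp_of_mem_strictPeriods hpos (Subgroup.mem_strictPeriods_iff.mpr hmem)
  -- hence the upper triangular `D` is `± T_x`: `l = ±1`
  obtain ⟨x, hx'⟩ := eq_upperRightHom_or_neg_of_upperTriangular hΓ hd hinf hD h10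
  have e : ∀ i j, (Matrix.SpecialLinearGroup.toGL D : GL (Fin 2) ℝ) i j = D i j := fun i j => rfl
  apply hl
  rcases hx' with h | h
  · have h00 := congrArg (fun g : GL (Fin 2) ℝ => (g 0 0 : ℝ)) h
    simp only [e] at h00
    rw [h00]; norm_num
  · have h00 := congrArg (fun g : GL (Fin 2) ℝ => (g 0 0 : ℝ)) h
    simp only [e] at h00
    have : D 0 0 = -1 := by rw [h00]; simp [Units.val_neg]
    rw [this]; norm_num

/-- The involution `S = (0 -1; 1 0)` swapping `0` and `∞`. [cite: Iwaniec2002, §1.2, PDF p. 12] -/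
def swapSL : SL(2, ℝ) := ⟨!![0, -1; 1, 0], by simp [Matrix.det_fin_two_of]⟩

/-- Conjugation by `S` exchanges the roles of the off-diagonal (and of the diagonal) entries:
`S X S⁻¹ = (w -z; -y x)` for `X = (x y; z w)`. [folklore] -/
theorem swap_conj_apply (X : SL(2, ℝ)) :
    (swapSL * X * swapSL⁻¹) 0 0 = X 1 1 ∧ (swapSL * X * swapSL⁻¹) 0 1 = -X 1 0 ∧
      (swapSL * X * swapSL⁻¹) 1 0 = -X 0 1 ∧ (swapSL * X * swapSL⁻¹) 1 1 = X 0 0 := by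
  simp only [swapSL, Matrix.SpecialLinearGroup.coe_mul, Matrix.SpecialLinearGroup.coe_inv,
    Matrix.adjugate_fin_two, Matrix.mul_apply, Fin.sum_univ_two, Matrix.of_apply, Matrix.cons_val',
    Matrix.cons_val_zero, Matrix.cons_val_one, Matrix.cons_val_fin_one, Matrix.empty_val']
  refine ⟨by ring, by ring, by ring, by ring⟩

/-- The same for lower triangular elements (conjugate by `S`). [cite: Iwaniec2002, Prop. 2.2 & §2.2, PDF pp. 27–30] -/
theorem apply_10_eq_zero_of_lower
    (hΓ : Γ ≤ (Matrix.SpecialLinearGroup.toGL : SL(2, ℝ) →* GL (Fin 2) ℝ).range)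
    (hd : IsDiscreteSubgroup Γ) {D X : SL(2, ℝ)}
    (hD : (Matrix.SpecialLinearGroup.toGL D : GL (Fin 2) ℝ) ∈ Γ)
    (hX : (Matrix.SpecialLinearGroup.toGL X : GL (Fin 2) ℝ) ∈ Γ)
    (h01 : D 0 1 = 0) (h10 : D 1 0 = 0) (hl : D 0 0 ^ 2 ≠ 1) (hX01 : X 0 1 = 0) : X 1 0 = 0 := by
  -- conjugate everything by `S`
  set G : GL (Fin 2) ℝ := Matrix.SpecialLinearGroup.toGL swapSL with hG
  set Γ' : Subgroup (GL (Fin 2) ℝ) := ConjAct.toConjAct G • Γ with hΓ'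
  have hΓ'le : Γ' ≤ (Matrix.SpecialLinearGroup.toGL : SL(2, ℝ) →* GL (Fin 2) ℝ).range := conj_le_range hΓ _
  have hd' : IsDiscreteSubgroup Γ' := hd.conj _
  have hmem : ∀ Y : SL(2, ℝ), (Matrix.SpecialLinearGroup.toGL Y : GL (Fin 2) ℝ) ∈ Γ →
      (Matrix.SpecialLinearGroup.toGL (swapSL * Y * swapSL⁻¹) : GL (Fin 2) ℝ) ∈ Γ' := by
    intro Y hY
    rw [hΓ', Subgroup.mem_pointwise_smul_iff_inv_smul_mem, ← ConjAct.toConjAct_inv, ConjAct.toConjAct_smul,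
      inv_inv, map_mul, map_mul, map_inv, hG]
    have : (Matrix.SpecialLinearGroup.toGL swapSL : GL (Fin 2) ℝ)⁻¹ *
        ((Matrix.SpecialLinearGroup.toGL swapSL : GL (Fin 2) ℝ) * Matrix.SpecialLinearGroup.toGL Y *
          (Matrix.SpecialLinearGroup.toGL swapSL : GL (Fin 2) ℝ)⁻¹) * Matrix.SpecialLinearGroup.toGL swapSL =
        Matrix.SpecialLinearGroup.toGL Y := by group
    rw [this]; exact hY
  obtain ⟨d00, d01, d10, d11⟩ := swap_conj_apply D
  obtain ⟨-, x01, x10, -⟩ := swap_conj_apply X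
  have hdD := diag_mul_eq_one h01
  have hl' : (swapSL * D * swapSL⁻¹) 0 0 ^ 2 ≠ 1 := by
    rw [d00]
    intro h
    apply hl
    have h2 : (D 0 0 * D 1 1) ^ 2 = 1 := by rw [hdD]; norm_num
    rw [mul_pow, h, mul_one] at h2
    exact h2
  have key := apply_01_eq_zero_of_upper hΓ'le hd' (hmem D hD) (hmem X hX)
    (by rw [d01, h10, neg_zero]) (by rw [d10, h01, neg_zero]) hl' (by rw [x10, hX01, neg_zero])
  rw [x01, neg_eq_zero] at key
  exact key

/-- If `X` conjugates `D = diag(l, m)` (`l ≠ m`) to `D` or to `D⁻¹` then `X` is diagonal or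
antidiagonal, i.e. `X` preserves the axis `{0, ∞}`. [folklore] -/
theorem diag_or_antidiag_of_conj_eq {D X : SL(2, ℝ)} (h01 : D 0 1 = 0) (h10 : D 1 0 = 0)
    (hlm : D 0 0 ≠ D 1 1) (h : X * D * X⁻¹ = D ∨ X * D * X⁻¹ = D⁻¹) :
    (X 0 1 = 0 ∧ X 1 0 = 0) ∨ (X 0 0 = 0 ∧ X 1 1 = 0) := by
  have hsub : D 0 0 - D 1 1 ≠ 0 := sub_ne_zero.mpr hlm
  rcases h with h | h
  · left
    have hXD : X * D = D * X := by
      calc X * D = X * D * X⁻¹ * X := by group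
        _ = D * X := by rw [h]
    obtain ⟨p00, p01, p10, p11⟩ := mul_apply_fin_two X D
    obtain ⟨q00, q01, q10, q11⟩ := mul_apply_fin_two D X
    have e01 := congrArg (fun g : SL(2, ℝ) => g 0 1) hXD
    have e10 := congrArg (fun g : SL(2, ℝ) => g 1 0) hXD
    simp only [p01, q01, p10, q10, h01, h10, mul_zero, zero_mul, add_zero, zero_add] at e01 e10
    constructor
    · have : X 0 1 * (D 1 1 - D 0 0) = 0 := by linear_combination e01
      exact (mul_eq_zero.mp this).resolve_right (fun h => hsub (by linarith))
    · have : X 1 0 * (D 0 0 - D 1 1) = 0 := by linear_combination e10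
      exact (mul_eq_zero.mp this).resolve_right hsub
  · right
    have hXD : X * D = D⁻¹ * X := by
      calc X * D = X * D * X⁻¹ * X := by group
        _ = D⁻¹ * X := by rw [h]
    obtain ⟨p00, p01, p10, p11⟩ := mul_apply_fin_two X D
    obtain ⟨q00, q01, q10, q11⟩ := mul_apply_fin_two D⁻¹ X
    obtain ⟨i00, i01, i10, i11⟩ := inv_apply_fin_two D
    have e00 := congrArg (fun g : SL(2, ℝ) => g 0 0) hXD
    have e11 := congrArg (fun g : SL(2, ℝ) => g 1 1) hXD
    simp only [p00, q00, p11, q11, i00, i01, i10, i11, h01, h10, mul_zero, zero_mul, add_zero,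
      zero_add, neg_zero] at e00 e11
    constructor
    · have : X 0 0 * (D 0 0 - D 1 1) = 0 := by linear_combination e00
      exact (mul_eq_zero.mp this).resolve_right hsub
    · have : X 1 1 * (D 1 1 - D 0 0) = 0 := by linear_combination e11
      exact (mul_eq_zero.mp this).resolve_right (fun h => hsub (by linarith))

/-- A diagonal conjugate of `D = diag(l, m)` is `D` or `D⁻¹` (same trace and determinant). [folklore] -/
theorem conj_eq_or_eq_inv_of_diag {D X : SL(2, ℝ)} (h01 : D 0 1 = 0) (h10 : D 1 0 = 0)
    (hY01 : (X * D * X⁻¹) 0 1 = 0) (hY10 : (X * D * X⁻¹) 1 0 = 0) :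
    X * D * X⁻¹ = D ∨ X * D * X⁻¹ = D⁻¹ := by
  set Y := X * D * X⁻¹ with hY
  have htr : Y 0 0 + Y 1 1 = D 0 0 + D 1 1 := by
    have := trace_conj_eq X⁻¹ D
    rw [inv_inv] at this
    exact this
  have hdY := diag_mul_eq_one hY01
  have hdD := diag_mul_eq_one h01
  obtain ⟨i00, i01, i10, i11⟩ := inv_apply_fin_two D
  -- `Y 0 0 ∈ {l, m}`
  have hprod : (Y 0 0 - D 0 0) * (Y 0 0 - D 1 1) = 0 := by
    linear_combination (-1 : ℝ) * hdY + hdD + Y 0 0 * htr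
  rcases mul_eq_zero.mp hprod with h | h
  · left
    have h00 : Y 0 0 = D 0 0 := sub_eq_zero.mp h
    have h11 : Y 1 1 = D 1 1 := by linarith
    ext i j
    fin_cases i <;> fin_cases j
    · exact h00
    · show Y 0 1 = D 0 1
      rw [hY01, h01]
    · show Y 1 0 = D 1 0
      rw [hY10, h10]
    · exact h11
  · right
    have h00 : Y 0 0 = D 1 1 := sub_eq_zero.mp h
    have h11 : Y 1 1 = D 0 0 := by linarith
    ext i j
    fin_cases i <;> fin_cases j
    · show Y 0 0 = D⁻¹ 0 0
      rw [h00, i00]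
    · show Y 0 1 = D⁻¹ 0 1
      rw [hY01, i01, h01, neg_zero]
    · show Y 1 0 = D⁻¹ 1 0
      rw [hY10, i10, h10, neg_zero]
    · show Y 1 1 = D⁻¹ 1 1
      rw [h11, i11]

/-- Rebalancing `Dᵏ X D⁻ᵏ` by powers of the diagonal `D = diag(l, m)` keeps the diagonal entries and
rescales the off-diagonal ones by `(l/m)^{±k}`; in particular their product is unchanged and
`|b|` can be brought into `[s, R s)` for any `s > 0`, `R = max(l², m²)`. [cite: Jorgensen1976, proof of Lemma 1] -/
theorem exists_rebalance {D : SL(2, ℝ)} (h01 : D 0 1 = 0) (h10 : D 1 0 = 0) (hl : D 0 0 ^ 2 ≠ 1)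
    (X : SL(2, ℝ)) {s : ℝ} (hs : 0 < s) (hb : X 0 1 ≠ 0) :
    ∃ k : ℤ, (D ^ k * X * D ^ (-k)) 0 0 = X 0 0 ∧ (D ^ k * X * D ^ (-k)) 1 1 = X 1 1 ∧
      (D ^ k * X * D ^ (-k)) 0 1 * (D ^ k * X * D ^ (-k)) 1 0 = X 0 1 * X 1 0 ∧
      s ≤ |(D ^ k * X * D ^ (-k)) 0 1| ∧
      |(D ^ k * X * D ^ (-k)) 0 1| < max (D 0 0 ^ 2) (D 1 1 ^ 2) * s := by
  have hdD := diag_mul_eq_one h01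
  have hl0 : D 0 0 ≠ 0 := fun h => by rw [h, zero_mul] at hdD; exact zero_ne_one hdD
  -- entries of `D^k` : a diagonal one-parameter family
  have hpow : ∀ k : ℤ, (D ^ k) 0 1 = 0 ∧ (D ^ k) 1 0 = 0 ∧ (D ^ k) 0 0 = D 0 0 ^ k ∧ (D ^ k) 1 1 = D 1 1 ^ k := by
    have hnat : ∀ n : ℕ, (D ^ n) 0 1 = 0 ∧ (D ^ n) 1 0 = 0 ∧ (D ^ n) 0 0 = D 0 0 ^ n ∧ (D ^ n) 1 1 = D 1 1 ^ n := by
      intro n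
      induction n with
      | zero => simp
      | succ n ih =>
        obtain ⟨a, b, c, d⟩ := ih
        obtain ⟨p00, p01, p10, p11⟩ := mul_apply_fin_two (D ^ n) D
        rw [pow_succ, p00, p01, p10, p11, a, b, c, d, h01, h10]
        refine ⟨by ring, by ring, by ring, by ring⟩
    intro k
    cases k with
    | ofNat n => simpa using hnat n
    | negSucc n =>
      obtain ⟨a, b, c, d⟩ := hnat (n + 1)
      obtain ⟨i00, i01, i10, i11⟩ := inv_apply_fin_two (D ^ (n + 1))
      rw [zpow_negSucc, i00, i01, i10, i11, a, b, c, d]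
      refine ⟨by simp, by simp, ?_, ?_⟩
      · rw [zpow_negSucc]
        have : D 1 1 = (D 0 0)⁻¹ := by field_simp; linarith
        rw [this, inv_pow]
      · rw [zpow_negSucc]
        have : D 0 0 = (D 1 1)⁻¹ := by
          have h11 : D 1 1 ≠ 0 := fun h => by rw [h, mul_zero] at hdD; exact zero_ne_one hdD
          field_simp; linarith
        rw [this, inv_pow]
  -- entries of the rebalanced element
  have hconj : ∀ k : ℤ, (D ^ k * X * D ^ (-k)) 0 0 = X 0 0 ∧ (D ^ k * X * D ^ (-k)) 1 1 = X 1 1 ∧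
      (D ^ k * X * D ^ (-k)) 0 1 = X 0 1 * (D 0 0 ^ 2) ^ k ∧
      (D ^ k * X * D ^ (-k)) 1 0 = X 1 0 * (D 1 1 ^ 2) ^ k := by
    intro k
    obtain ⟨a, b, c, d⟩ := hpow k
    obtain ⟨a', b', c', d'⟩ := hpow (-k)
    obtain ⟨p00, p01, p10, p11⟩ := mul_apply_fin_two (D ^ k * X) (D ^ (-k))
    obtain ⟨q00, q01, q10, q11⟩ := mul_apply_fin_two (D ^ k) X
    rw [p00, p01, p10, p11, q00, q01, q10, q11, a, b, c, d, a', b', c', d']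
    have e1 : D 0 0 ^ k * D 0 0 ^ (-k) = 1 := by rw [← zpow_add₀ hl0, add_neg_cancel, zpow_zero]
    have h11 : D 1 1 ≠ 0 := fun h => by rw [h, mul_zero] at hdD; exact zero_ne_one hdD
    have e2 : D 1 1 ^ k * D 1 1 ^ (-k) = 1 := by rw [← zpow_add₀ h11, add_neg_cancel, zpow_zero]
    have e3 : D 0 0 ^ k * D 1 1 ^ (-k) = (D 0 0 ^ 2) ^ k := by
      have : D 1 1 = (D 0 0)⁻¹ := by field_simp; linarith
      rw [this, _root_.inv_zpow, ← _root_.zpow_neg, neg_neg, ← zpow_add₀ hl0, ← two_mul, _root_.zpow_mul, zpow_ofNat]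
    have e4 : D 1 1 ^ k * D 0 0 ^ (-k) = (D 1 1 ^ 2) ^ k := by
      have : D 0 0 = (D 1 1)⁻¹ := by field_simp; linarith
      rw [this, _root_.inv_zpow, ← _root_.zpow_neg, neg_neg, ← zpow_add₀ h11, ← two_mul, _root_.zpow_mul, zpow_ofNat]
    refine ⟨?_, ?_, ?_, ?_⟩
    · simp only [mul_zero, zero_mul, add_zero]
      calc D 0 0 ^ k * X 0 0 * D 0 0 ^ (-k) = X 0 0 * (D 0 0 ^ k * D 0 0 ^ (-k)) := by ring
        _ = X 0 0 := by rw [e1, mul_one]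
    · simp only [mul_zero, zero_mul, zero_add]
      calc D 1 1 ^ k * X 1 1 * D 1 1 ^ (-k) = X 1 1 * (D 1 1 ^ k * D 1 1 ^ (-k)) := by ring
        _ = X 1 1 := by rw [e2, mul_one]
    · simp only [mul_zero, zero_mul, add_zero, zero_add]
      calc D 0 0 ^ k * X 0 1 * D 1 1 ^ (-k) = X 0 1 * (D 0 0 ^ k * D 1 1 ^ (-k)) := by ring
        _ = X 0 1 * (D 0 0 ^ 2) ^ k := by rw [e3]
    · simp only [mul_zero, zero_mul, add_zero, zero_add]
      calc D 1 1 ^ k * X 1 0 * D 0 0 ^ (-k) = X 1 0 * (D 1 1 ^ k * D 0 0 ^ (-k)) := by ring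
        _ = X 1 0 * (D 1 1 ^ 2) ^ k := by rw [e4]
  -- the ratio `r = l²` and its inverse `m²`
  set r : ℝ := D 0 0 ^ 2 with hr
  have hr0 : 0 < r := by rw [hr]; positivity
  have hrinv : D 1 1 ^ 2 = r⁻¹ := by
    have : D 1 1 = (D 0 0)⁻¹ := by field_simp; linarith
    rw [this, inv_pow]
  have hprod : ∀ k : ℤ, (D 0 0 ^ 2) ^ k * (D 1 1 ^ 2) ^ k = 1 := by
    intro k
    rw [hrinv, ← mul_zpow, mul_inv_cancel₀ hr0.ne', _root_.one_zpow]
  -- choose the exponent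
  have hx : 0 < |X 0 1| / s := div_pos (abs_pos.mpr hb) hs
  have hprod' : ∀ k : ℤ, (D ^ k * X * D ^ (-k)) 0 1 * (D ^ k * X * D ^ (-k)) 1 0 = X 0 1 * X 1 0 := by
    intro k
    rw [(hconj k).2.2.1, (hconj k).2.2.2]
    calc X 0 1 * r ^ k * (X 1 0 * (D 1 1 ^ 2) ^ k) = X 0 1 * X 1 0 * (r ^ k * (D 1 1 ^ 2) ^ k) := by ring
      _ = X 0 1 * X 1 0 := by rw [hprod, mul_one]
  have habs : ∀ k : ℤ, |(D ^ k * X * D ^ (-k)) 0 1| = |X 0 1| * r ^ k := fun k => by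
    rw [(hconj k).2.2.1, abs_mul, abs_of_pos (zpow_pos hr0 _)]
  rcases lt_or_gt_of_ne hl with hlt | hgt
  · -- `r < 1`: with `y = r⁻¹ > 1` and `yⁿ ≤ |b|/s < yⁿ⁺¹` take `k = n`, `|b'| = |b| rⁿ = |b|/yⁿ`
    have hy : 1 < r⁻¹ := (one_lt_inv₀ hr0).mpr hlt
    obtain ⟨n, hn1, hn2⟩ := exists_mem_Ico_zpow hx hy
    have hz : 0 < r ^ n := zpow_pos hr0 _
    rw [_root_.inv_zpow] at hn1
    rw [zpow_add_one₀ (inv_ne_zero hr0.ne'), _root_.inv_zpow] at hn2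
    refine ⟨n, (hconj n).1, (hconj n).2.1, hprod' n, ?_, ?_⟩
    · rw [habs]
      have h := (le_div_iff₀ hs).mp hn1
      rw [inv_mul_le_iff₀ hz] at h
      linarith [mul_comm (r ^ n) (|X 0 1|)]
    · rw [habs]
      have h := (div_lt_iff₀ hs).mp hn2
      have hmax : r⁻¹ ≤ max r (D 1 1 ^ 2) := by rw [hrinv]; exact le_max_right _ _
      have h1 : |X 0 1| * r ^ n < r⁻¹ * s := by
        have := mul_lt_mul_of_pos_right h hz
        calc |X 0 1| * r ^ n < (r ^ n)⁻¹ * r⁻¹ * s * r ^ n := this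
          _ = r⁻¹ * s := by field_simp
      calc |X 0 1| * r ^ n < r⁻¹ * s := h1
        _ ≤ max r (D 1 1 ^ 2) * s := by gcongr
  · -- `r > 1`: with `rⁿ ≤ |b|/s < rⁿ⁺¹` take `k = -n`, `|b'| = |b| r⁻ⁿ`
    obtain ⟨n, hn1, hn2⟩ := exists_mem_Ico_zpow hx hgt
    have hz : 0 < r ^ n := zpow_pos hr0 _
    have eneg : r ^ (-n) = (r ^ n)⁻¹ := _root_.zpow_neg r n
    refine ⟨-n, (hconj (-n)).1, (hconj (-n)).2.1, hprod' (-n), ?_, ?_⟩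
    · rw [habs, eneg, ← div_eq_mul_inv, le_div_iff₀ hz]
      have h := (le_div_iff₀ hs).mp hn1
      linarith [mul_comm (r ^ n) s]
    · rw [habs, eneg, ← div_eq_mul_inv, div_lt_iff₀ hz]
      have h := (div_lt_iff₀ hs).mp hn2
      rw [zpow_add_one₀ hr0.ne'] at h
      have hmax : r ≤ max r (D 1 1 ^ 2) := le_max_left _ _
      calc |X 0 1| < r ^ n * r * s := h
        _ = r * s * r ^ n := by ring
        _ ≤ max r (D 1 1 ^ 2) * s * r ^ n := by gcongr

/-- The rebalanced element as a member of `Γ` (when `D, X ∈ Γ`). [cite: Jorgensen1976, proof of Lemma 1] -/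
theorem exists_rebalanced_mem {D X : SL(2, ℝ)}
    (hD : (Matrix.SpecialLinearGroup.toGL D : GL (Fin 2) ℝ) ∈ Γ)
    (hX : (Matrix.SpecialLinearGroup.toGL X : GL (Fin 2) ℝ) ∈ Γ)
    (h01 : D 0 1 = 0) (h10 : D 1 0 = 0) (hl : D 0 0 ^ 2 ≠ 1) {s : ℝ} (hs : 0 < s) (hb : X 0 1 ≠ 0) :
    ∃ Y : SL(2, ℝ), (Matrix.SpecialLinearGroup.toGL Y : GL (Fin 2) ℝ) ∈ Γ ∧ Y 0 0 = X 0 0 ∧ Y 1 1 = X 1 1 ∧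
      Y 0 1 * Y 1 0 = X 0 1 * X 1 0 ∧ s ≤ |Y 0 1| ∧ |Y 0 1| < max (D 0 0 ^ 2) (D 1 1 ^ 2) * s := by
  obtain ⟨k, h1, h2, h3, h4, h5⟩ := exists_rebalance h01 h10 hl X hs hb
  refine ⟨D ^ k * X * D ^ (-k), ?_, h1, h2, h3, h4, h5⟩
  rw [map_mul, map_mul, map_zpow, map_zpow]
  exact Γ.mul_mem (Γ.mul_mem (Γ.zpow_mem hD _) hX) (Γ.zpow_mem hD _)

/-- `l + l⁻¹ ≠ 0` and `l ≠ l⁻¹` for the diagonal `D = diag(l, l⁻¹)` with `l² ≠ 1`. [folklore] -/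
theorem diag_ne_and_trace_ne {D : SL(2, ℝ)} (h01 : D 0 1 = 0) (hl : D 0 0 ^ 2 ≠ 1) :
    D 0 0 ≠ D 1 1 ∧ D 0 0 + D 1 1 ≠ 0 := by
  have hdD := diag_mul_eq_one h01
  constructor
  · intro h
    apply hl
    rw [← h] at hdD
    nlinarith
  · intro h
    have : D 1 1 = -D 0 0 := by linarith
    rw [this] at hdD
    nlinarith [sq_nonneg (D 0 0)]

set_option maxHeartbeats 400000 in
/-- **Jørgensen's inequality, hyperbolic case, normalised.** Let `Γ ≤ SL₂(ℝ)` (inside `GL₂(ℝ)`)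
be discrete, `D = diag(l, l⁻¹) ∈ Γ` with `l² ≠ 1`, and `B = (a b; c d) ∈ Γ`. If
`|tr²D - 4| + |tr(DBD⁻¹B⁻¹) - 2| = (l - l⁻¹)²(1 + |bc|) < 1` then `B` is diagonal or antidiagonal,
i.e. `B` preserves the axis `{0, ∞}` of `D` (the group `⟨D, B⟩` is elementary). Proof: along
`B_{n+1} = B_nDB_n⁻¹` the products `t_n = b_nc_n` satisfy `|t_{n+1}| ≤ J_n|t_n|`; if some `t_N = 0`,
`B_N` is triangular, hence diagonal (`apply_01_eq_zero_of_upper`), hence `D^{±1}`, and `B_{N-1}`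
preserves the axis, which for `N - 1 ≥ 1` is impossible by the trace unless it is diagonal — so
`N ≤ 1` and `B` preserves the axis; if no `t_n` vanishes, the rebalanced `D^{k_n}B_nD^{-k_n} ∈ Γ`
are infinitely many distinct elements of one norm ball. [cite: Jorgensen1976, Lemma 1 & Thm 1] [cite: Beardon1983, Thm 5.4.1] -/
theorem jorgensen_hyperbolic_diag
    (hΓ : Γ ≤ (Matrix.SpecialLinearGroup.toGL : SL(2, ℝ) →* GL (Fin 2) ℝ).range)
    (hd : IsDiscreteSubgroup Γ) {D B : SL(2, ℝ)}
    (hD : (Matrix.SpecialLinearGroup.toGL D : GL (Fin 2) ℝ) ∈ Γ)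
    (hB : (Matrix.SpecialLinearGroup.toGL B : GL (Fin 2) ℝ) ∈ Γ)
    (h01 : D 0 1 = 0) (h10 : D 1 0 = 0) (hl : D 0 0 ^ 2 ≠ 1)
    (hJ : |(D 0 0 + D 1 1) ^ 2 - 4| + |(D * B * D⁻¹ * B⁻¹) 0 0 + (D * B * D⁻¹ * B⁻¹) 1 1 - 2| < 1) :
    (B 0 1 = 0 ∧ B 1 0 = 0) ∨ (B 0 0 = 0 ∧ B 1 1 = 0) := by
  classical
  rw [jorgensenJ_diag_eq h01 h10] at hJ
  obtain ⟨hlm, htr⟩ := diag_ne_and_trace_ne h01 hl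
  set μ : ℝ := (D 0 0 - D 1 1) ^ 2 with hμ
  have hμ0 : 0 < μ := by
    have := sub_ne_zero.mpr hlm
    positivity
  set Bn : ℕ → SL(2, ℝ) := jorgensenSeq D B with hBn
  have hmemn : ∀ n, (Matrix.SpecialLinearGroup.toGL (Bn n) : GL (Fin 2) ℝ) ∈ Γ :=
    toGL_jorgensenSeq_mem hD hB
  set t : ℕ → ℝ := fun n => (Bn n) 0 1 * (Bn n) 1 0 with ht
  have hrec : ∀ n, t (n + 1) = -(t n) * (1 + t n) * μ := fun n => by
    simp only [ht, hBn, jorgensenSeq_succ]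
    exact offDiag_conj_diag h01 h10 _
  have habs_rec : ∀ n, |t (n + 1)| ≤ μ * |t n| * (1 + |t n|) := by
    intro n
    rw [hrec, abs_mul, abs_mul, abs_neg, abs_of_nonneg hμ0.le]
    have h1 : |1 + t n| ≤ 1 + |t n| := (abs_add_le _ _).trans (by rw [abs_one])
    have hμt : 0 ≤ μ * |t n| := mul_nonneg hμ0.le (abs_nonneg _)
    calc |t n| * |1 + t n| * μ = μ * |t n| * |1 + t n| := by ring
      _ ≤ μ * |t n| * (1 + |t n|) := mul_le_mul_of_nonneg_left h1 hμt
  set J₀ : ℝ := μ * (1 + |t 0|) with hJ₀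
  have hJ0 : J₀ < 1 := hJ
  have hmono : ∀ n, |t n| ≤ |t 0| := by
    intro n
    induction n with
    | zero => exact le_rfl
    | succ n ih =>
      calc |t (n + 1)| ≤ μ * |t n| * (1 + |t n|) := habs_rec n
        _ ≤ μ * |t n| * (1 + |t 0|) := by
            have := mul_nonneg hμ0.le (abs_nonneg (t n))
            nlinarith
        _ = J₀ * |t n| := by rw [hJ₀]; ring
        _ ≤ 1 * |t n| := mul_le_mul_of_nonneg_right hJ0.le (abs_nonneg _)
        _ ≤ |t 0| := by rw [one_mul]; exact ih
  -- a vanishing `t_n` makes `B_n` triangular, hence diagonal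
  have hdiag_of_t : ∀ n, t n = 0 → (Bn n) 0 1 = 0 ∧ (Bn n) 1 0 = 0 := by
    intro n htn
    rcases mul_eq_zero.mp htn with h | h
    · exact ⟨h, apply_10_eq_zero_of_lower hΓ hd hD (hmemn n) h01 h10 hl h⟩
    · exact ⟨apply_01_eq_zero_of_upper hΓ hd hD (hmemn n) h01 h10 hl h, h⟩
  by_cases hex : ∃ n, t n = 0
  · -- Case A: take the least such `N`; then `N ≤ 1`
    obtain ⟨N, hN, hmin⟩ : ∃ N, t N = 0 ∧ ∀ m < N, t m ≠ 0 :=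
      ⟨Nat.find hex, Nat.find_spec hex, fun m hm => Nat.find_min hex hm⟩
    obtain ⟨hb, hc⟩ := hdiag_of_t N hN
    rcases N with _ | k
    · left
      exact ⟨hb, hc⟩
    · -- `B_{k+1} = B_k D B_k⁻¹` is diagonal, hence `D^{±1}`, so `B_k` preserves the axis
      have hk : t k ≠ 0 := hmin k (Nat.lt_succ_self k)
      have e : Bn (k + 1) = Bn k * D * (Bn k)⁻¹ := by simp only [hBn, jorgensenSeq_succ]
      rw [e] at hb hc
      have h1 := conj_eq_or_eq_inv_of_diag h01 h10 hb hc
      rcases diag_or_antidiag_of_conj_eq h01 h10 hlm h1 with ⟨hb', hc'⟩ | ⟨ha', hd'⟩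
      · exact absurd (by simp only [ht, hb', zero_mul]) hk
      · rcases k with _ | j
        · right
          exact ⟨ha', hd'⟩
        · -- `B_{j+1}` is a conjugate of `D`: its trace is `l + l⁻¹ ≠ 0`, not antidiagonal
          exfalso
          apply htr
          have e' : Bn (j + 1) = Bn j * D * (Bn j)⁻¹ := by simp only [hBn, jorgensenSeq_succ]
          have := trace_conj_eq (Bn j)⁻¹ D
          rw [inv_inv, ← e', ha', hd', zero_add] at this
          exact this.symm
  · -- Case B: no `t_n` vanishes; rebalance and contradict discreteness
    push Not at hex
    have hpos : ∀ n, 0 < |t n| := fun n => abs_pos.mpr (hex n)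
    have hanti : StrictAnti fun n => |t n| := by
      refine strictAnti_nat_of_succ_lt fun n => ?_
      calc |t (n + 1)| ≤ μ * |t n| * (1 + |t n|) := habs_rec n
        _ ≤ μ * |t n| * (1 + |t 0|) := by
            have := mul_nonneg hμ0.le (abs_nonneg (t n))
            nlinarith [hmono n]
        _ = J₀ * |t n| := by rw [hJ₀]; ring
        _ < 1 * |t n| := by gcongr; exact hpos n
        _ = |t n| := one_mul _
    have htinj : Function.Injective t := fun m n h => hanti.injective (by simp only [h])
    -- rebalanced iterates
    have hb0 : ∀ n, (Bn n) 0 1 ≠ 0 := fun n h => hex n (by simp only [ht, h, zero_mul])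
    have hs : ∀ n, 0 < Real.sqrt |t n| := fun n => Real.sqrt_pos.mpr (hpos n)
    choose C hCmem hC00 hC11 hCprod hCle hClt using
      fun n => exists_rebalanced_mem hD (hmemn n) h01 h10 hl (hs n) (hb0 n)
    -- bounds: diagonal entries of `B_{n+1}`
    set R : ℝ := max (D 0 0 ^ 2) (D 1 1 ^ 2) with hR
    set K : ℝ := (1 + |t 0|) * |D 0 0| + |t 0| * |D 1 1| + (1 + |t 0|) * |D 1 1| + |t 0| * |D 0 0| with hK
    have hdiag_bd : ∀ n, |(Bn (n + 1)) 0 0| ≤ K ∧ |(Bn (n + 1)) 1 1| ≤ K := by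
      intro n
      have e : Bn (n + 1) = Bn n * D * (Bn n)⁻¹ := by simp only [hBn, jorgensenSeq_succ]
      obtain ⟨e00, -, -, e11⟩ := conj_diag_apply h01 h10 (Bn n)
      have hdet := det_rel (Bn n)
      have had : (Bn n) 0 0 * (Bn n) 1 1 = 1 + t n := by simp only [ht]; linarith
      rw [e, e00, e11, had]
      have h1 : |(1 + t n) * D 0 0 - t n * D 1 1| ≤ (1 + |t 0|) * |D 0 0| + |t 0| * |D 1 1| := by
        calc |(1 + t n) * D 0 0 - t n * D 1 1| ≤ |(1 + t n) * D 0 0| + |t n * D 1 1| := abs_sub _ _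
          _ = |1 + t n| * |D 0 0| + |t n| * |D 1 1| := by rw [abs_mul, abs_mul]
          _ ≤ (1 + |t n|) * |D 0 0| + |t n| * |D 1 1| := by
              have := (abs_add_le 1 (t n)).trans (by rw [abs_one])
              nlinarith [abs_nonneg (D 0 0)]
          _ ≤ (1 + |t 0|) * |D 0 0| + |t 0| * |D 1 1| := by
              nlinarith [hmono n, abs_nonneg (D 0 0), abs_nonneg (D 1 1)]
      have h2 : |(1 + t n) * D 1 1 - t n * D 0 0| ≤ (1 + |t 0|) * |D 1 1| + |t 0| * |D 0 0| := by
        calc |(1 + t n) * D 1 1 - t n * D 0 0| ≤ |(1 + t n) * D 1 1| + |t n * D 0 0| := abs_sub _ _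
          _ = |1 + t n| * |D 1 1| + |t n| * |D 0 0| := by rw [abs_mul, abs_mul]
          _ ≤ (1 + |t n|) * |D 1 1| + |t n| * |D 0 0| := by
              have := (abs_add_le 1 (t n)).trans (by rw [abs_one])
              nlinarith [abs_nonneg (D 1 1)]
          _ ≤ (1 + |t 0|) * |D 1 1| + |t 0| * |D 0 0| := by
              nlinarith [hmono n, abs_nonneg (D 0 0), abs_nonneg (D 1 1)]
      have hK1 : (1 + |t 0|) * |D 0 0| + |t 0| * |D 1 1| ≤ K := by
        rw [hK]; nlinarith [abs_nonneg (t 0), abs_nonneg (D 1 1), abs_nonneg (D 0 0)]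
      have hK2 : (1 + |t 0|) * |D 1 1| + |t 0| * |D 0 0| ≤ K := by
        rw [hK]; nlinarith [abs_nonneg (t 0), abs_nonneg (D 1 1), abs_nonneg (D 0 0)]
      rw [ht] at h1 h2
      exact ⟨h1.trans hK1, h2.trans hK2⟩
    -- the norm bound for `C_{n+1}`
    have hs0 : ∀ n, Real.sqrt |t n| ≤ Real.sqrt |t 0| := fun n => Real.sqrt_le_sqrt (hmono n)
    have hl0 : D 0 0 ≠ 0 := by
      have := diag_mul_eq_one h01
      intro h; rw [h, zero_mul] at this; exact zero_ne_one this
    have hR0 : 0 < R := by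
      have h1 : (0 : ℝ) < D 0 0 ^ 2 := by positivity
      rw [hR]
      exact lt_of_lt_of_le h1 (le_max_left _ _)
    have hsq : ∀ {x M : ℝ}, |x| ≤ M → x ^ 2 ≤ M ^ 2 := fun {x M} h => by
      rw [← sq_abs]; exact pow_le_pow_left₀ (abs_nonneg x) h 2
    have hball : ∀ n, slNormSq (C (n + 1)) ≤ K ^ 2 + (R * Real.sqrt |t 0|) ^ 2 + Real.sqrt |t 0| ^ 2 + K ^ 2 := by
      intro n
      rw [slNormSq_def, hC00 (n + 1), hC11 (n + 1)]
      obtain ⟨ha, hd'⟩ := hdiag_bd n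
      -- the off-diagonal entries after rebalancing
      have hb : |(C (n + 1)) 0 1| ≤ R * Real.sqrt |t 0| := by
        have h2 : R * Real.sqrt |t (n + 1)| ≤ R * Real.sqrt |t 0| :=
          mul_le_mul_of_nonneg_left (hs0 (n + 1)) hR0.le
        exact (le_of_lt (hClt (n + 1))).trans h2
      have hc : |(C (n + 1)) 1 0| ≤ Real.sqrt |t 0| := by
        have hbc : (C (n + 1)) 0 1 * (C (n + 1)) 1 0 = t (n + 1) := hCprod (n + 1)
        have hb' : Real.sqrt |t (n + 1)| ≤ |(C (n + 1)) 0 1| := hCle (n + 1)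
        have hb'0 : 0 < |(C (n + 1)) 0 1| := lt_of_lt_of_le (hs (n + 1)) hb'
        have e : |(C (n + 1)) 1 0| = |t (n + 1)| / |(C (n + 1)) 0 1| := by
          rw [← hbc, abs_mul, mul_div_cancel_left₀ _ hb'0.ne']
        rw [e, div_le_iff₀ hb'0]
        calc |t (n + 1)| = Real.sqrt |t (n + 1)| * Real.sqrt |t (n + 1)| :=
              (Real.mul_self_sqrt (abs_nonneg _)).symm
          _ ≤ Real.sqrt |t 0| * |(C (n + 1)) 0 1| :=
              mul_le_mul (hs0 (n + 1)) hb' (Real.sqrt_nonneg _) (Real.sqrt_nonneg _)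
      have e1 := hsq ha
      have e2 := hsq hd'
      have e3 := hsq hb
      have e4 := hsq hc
      linarith
    have hinj : Function.Injective fun n => C (n + 1) := by
      intro m n hmn
      have h1 : t (m + 1) = t (n + 1) := by
        have := congrArg (fun g : SL(2, ℝ) => g 0 1 * g 1 0) hmn
        simp only at this
        rw [hCprod (m + 1), hCprod (n + 1)] at this
        exact this
      have := htinj h1
      omega
    exact (not_injective_of_slNormSq_le hd (fun n => hCmem (n + 1)) hball hinj).elim

end Hyperbolic

end Fuchsian

end Literature.NumberTheory.Automorphic

end
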